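import Mathlib
import HarnessLib
import Literature.Probability.MarkovChains.LogSobolevConstant

/-!
# The spectral high-temperature log-Sobolev inequality for Ising models with a general coupling matrix
# (Bauerschmidt–Bodineau 2019, via Bauerschmidt–Bodineau–Dagallier 2024, Theorem 10)

Conventions of `PeskunOrdering.lean` (`dirichletForm π K F = ½ Σ_{σ,σ'} π(σ) K(σ,σ') (F σ − F σ')²`) and
`LogSobolevConstant.lean` (`entForm`, `logSobolevConst`).  Requested context: cell `ym-ir` (census rows B3/B4/B16:
the printed «X ⇒ volume-uniform log-Sobolev» criteria; this is the DISCRETE-SPIN one whose hypothesis is a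
SPECTRAL high-temperature condition — it reaches `β < 1` in the spectral normalisation for every finite set
`Λ`, every symmetric coupling matrix with spectrum in `[0,1]` (e.g. the Sherrington–Kirkpatrick spin glass) and
every external field, uniformly in all of them).  A sibling-setting criterion; nothing here is a statement about
gauge theories.

SOURCE (held, read on the hub's materialised pages `paper:arxiv-2307.07619`): R. Bauerschmidt, T. Bodineau,
B. Dagallier, *Stochastic dynamics and the Polchinski equation: an introduction*, Probab. Surveys 21 (2024),
arXiv:2307.07619 [BBD]: §2.1 p0007 L1–4 (`Ent_ν(F) = E_ν[Φ(F)] − Φ(E_ν[F])`, `Φ(x) = x log x`), the discrete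
Dirichlet form (e:Dirichlet-discrete) p0006 L73–93 and its «standard» choice `c ≡ 1` p0006 L104–119, §6.4.1
(eq: Ising model-bis) p0037 L145–150 «The Ising model with coupling matrix `A` at inverse temperature `β > 0` and
(site-dependent) external field `h` on a finite set `Λ` is defined by
`E_μ[F] ∝ Σ_{σ∈{±1}^Λ} e^{−½(σ,βAσ)+(h,σ)} F(σ)`», p0038 L1–5 (WLOG `A` positive definite with spectral radius
`≤ 1`), §6.4.3 (e:Ising-Dirichlet-standard) p0039 L5–8 `D_μ(F) = ½ Σ_{x∈Λ} E_μ[(F(σ) − F(σ^x))²]`, and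
**Theorem 10** p0039 L108–118: «(Spectral high temperature condition [MR3926125]).  For `β < 1` (under the
conventions stated below (eq: Ising model-bis) [«the coupling matrix `A` has spectrum in `[0,1]`», L105]), the
Ising model `μ` satisfies the log-Sobolev inequality: for each `F : {−1,1}^Λ → ℝ₊`,
`Ent_μ(F) ≤ (1 + 2β/(1−β)) D_μ(√F)`.»  The result is R. Bauerschmidt, T. Bodineau, *A very simple proof of the
LSI for high temperature spin systems*, J. Funct. Anal. 276 (2019) 2582–2588 ([BBD]'s [MR3926125]; not held —
cited through [BBD]). [cite: BauerschmidtBodineauDagallier2023] [cite: BauerschmidtBodineau2019]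

## Contents

* `SpectralIsing.flip x σ = σ^x`, `SpectralIsing.flipKernel` — the single-spin-flip incidence matrix
  `K(σ,σ') = #{x : σ' = σ^x} ∈ {0,1}`, for which the tree's `dirichletForm π K` IS [BBD]'s standard Dirichlet
  form: `dirichletForm π flipKernel F = ½ Σ_σ π(σ) Σ_x (F σ − F σ^x)²` (`dirichletForm_flipKernel`, PROVED).
* `SpectralIsing.weight A h β σ = exp(−½ β (σ, Aσ) + (h, σ))`, `SpectralIsing.law A h β` = the normalised Ising
  law (eq: Ising model-bis); `law_pos`, `sum_law` (PROVED).
* `SpectralIsing.ent π F = Σ π F log F − (Σ π F) log (Σ π F)` ([BBD] §2.1).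
* NAMED FACT `SpectralIsing.BauerschmidtBodineau2019_logSobolev` — [BBD] Theorem 10 as displayed.

Faithfulness notes.  «Spectrum in `[0,1]`» for the real symmetric `A` is typed as `A.PosSemidef ∧
(1 − A).PosSemidef`; `β > 0` is [BBD]'s standing convention (p0037 L145), `β < 1` the hypothesis; `F ≥ 0`
pointwise («`F : {−1,1}^Λ → ℝ₊`»), with Lean's `0 · log 0 = 0` matching `Φ(0) = 0`; `√F` is `Real.sqrt ∘ F`.
In Saloff-Coste's normalisation of `LogSobolevConstant.lean` (`α = inf 𝓔(f)/𝓛(f)`, `𝓛(f) = Ent_π(f²)`) the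
theorem says `α(law, flipKernel) ≥ (1−β)/(1+β)` (take `F = f²`, `D(|f|) ≤ D(f)`); that corollary is not restated.
-/

namespace Literature.Probability.MarkovChains

namespace SpectralIsing

open Finset Matrix

section Flip

variable {Λ : Type*} [Fintype Λ] [DecidableEq Λ]

/-! ## Spin flips and the standard single-flip Dirichlet form -/

/-- `σ^x`: the configuration `σ` with the spin at `x` reversed ([BBD] §2.1, p0006 L73).
[cite: BauerschmidtBodineauDagallier2023, §2.1 (e:Dirichlet-discrete)] -/
def flip (x : Λ) (σ : Λ → ℤˣ) : Λ → ℤˣ := Function.update σ x (-σ x)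

/-- The single-spin-flip incidence matrix `K(σ,σ') = #{x : σ' = σ^x}` (`∈ {0,1}`): with it the tree's
`dirichletForm π K` is the STANDARD Dirichlet form of [BBD] (jump rates `c ≡ 1` in (e:Dirichlet-discrete),
p0006 L104–119). [cite: BauerschmidtBodineauDagallier2023, §2.1 (e:Dirichlet-discrete)] -/
noncomputable def flipKernel : Matrix (Λ → ℤˣ) (Λ → ℤˣ) ℝ :=
  fun σ σ' => ∑ x, if σ' = flip x σ then (1 : ℝ) else 0

omit [Fintype Λ] in
/-- `σ^x` evaluated. [cite: BauerschmidtBodineauDagallier2023, §2.1] -/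
theorem flip_apply (x : Λ) (σ : Λ → ℤˣ) (y : Λ) : flip x σ y = if y = x then -σ x else σ y := by
  unfold flip; rw [Function.update_apply]

/-- **The standard Dirichlet form** ([BBD] (e:Ising-Dirichlet-standard) p0039 L5–8):
`dirichletForm π flipKernel F = ½ Σ_σ π(σ) Σ_{x∈Λ} (F(σ) − F(σ^x))²`, i.e. `D_π(F) = ½ Σ_x E_π[(F(σ) − F(σ^x))²]`.
[cite: BauerschmidtBodineauDagallier2023, §6.4.3 (e:Ising-Dirichlet-standard)] -/
theorem dirichletForm_flipKernel (π : (Λ → ℤˣ) → ℝ) (F : (Λ → ℤˣ) → ℝ) :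
    dirichletForm π flipKernel F = (1 / 2) * ∑ σ, π σ * ∑ x, (F σ - F (flip x σ)) ^ 2 := by
  unfold dirichletForm flipKernel
  congr 1
  refine sum_congr rfl fun σ _ => ?_
  -- `Σ_{σ'} π σ (Σ_x [σ' = σ^x]) (Fσ − Fσ')² = π σ Σ_x (Fσ − F σ^x)²`
  have : ∀ σ' : Λ → ℤˣ, π σ * (∑ x, if σ' = flip x σ then (1 : ℝ) else 0) * (F σ - F σ') ^ 2 =
      ∑ x, (if σ' = flip x σ then π σ * (F σ - F σ') ^ 2 else 0) := by
    intro σ'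
    rw [mul_sum, sum_mul]
    refine sum_congr rfl fun x _ => ?_
    split_ifs <;> simp
  simp_rw [this]
  rw [sum_comm, mul_sum]
  refine sum_congr rfl fun x _ => ?_
  rw [sum_ite_eq' univ (flip x σ)]
  simp

/-! ## The Ising law with a general coupling matrix ([BBD] (eq: Ising model-bis)) -/

/-- The spin `σ_x ∈ {−1, +1}` as a real number. [cite: BauerschmidtBodineauDagallier2023, §6.4.1] -/
def spin (σ : Λ → ℤˣ) (x : Λ) : ℝ := ((σ x : ℤ) : ℝ)

/-- The Boltzmann weight `exp(−½ β (σ, A σ) + (h, σ))` of [BBD] (eq: Ising model-bis) p0037 L145–150.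
[cite: BauerschmidtBodineauDagallier2023, §6.4.1 (eq: Ising model-bis)] -/
noncomputable def weight (A : Matrix Λ Λ ℝ) (h : Λ → ℝ) (β : ℝ) (σ : Λ → ℤˣ) : ℝ :=
  Real.exp (-(1 / 2) * β * (∑ x, ∑ y, spin σ x * A x y * spin σ y) + ∑ x, h x * spin σ x)

/-- The partition function `Σ_σ exp(−½ β (σ, Aσ) + (h, σ))`. [cite: BauerschmidtBodineauDagallier2023, §6.4.1 (eq: Ising model-bis)] -/
noncomputable def Z (A : Matrix Λ Λ ℝ) (h : Λ → ℝ) (β : ℝ) : ℝ := ∑ σ, weight A h β σ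

/-- **The Ising model with coupling matrix `A`, inverse temperature `β` and field `h` on the finite set `Λ`**:
`μ(σ) = exp(−½ β (σ, Aσ) + (h, σ)) / Z` ([BBD] (eq: Ising model-bis)).
[cite: BauerschmidtBodineauDagallier2023, §6.4.1 (eq: Ising model-bis)] -/
noncomputable def law (A : Matrix Λ Λ ℝ) (h : Λ → ℝ) (β : ℝ) (σ : Λ → ℤˣ) : ℝ := weight A h β σ / Z A h β

omit [DecidableEq Λ] in
/-- The weights are positive. [cite: BauerschmidtBodineauDagallier2023, §6.4.1] -/
theorem weight_pos (A : Matrix Λ Λ ℝ) (h : Λ → ℝ) (β : ℝ) (σ : Λ → ℤˣ) : 0 < weight A h β σ :=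
  Real.exp_pos _

/-- The partition function is positive. [cite: BauerschmidtBodineauDagallier2023, §6.4.1] -/
theorem Z_pos (A : Matrix Λ Λ ℝ) (h : Λ → ℝ) (β : ℝ) : 0 < Z A h β :=
  sum_pos (fun σ _ => weight_pos A h β σ) ⟨fun _ => 1, mem_univ _⟩

/-- The Ising law is a positive probability vector. [cite: BauerschmidtBodineauDagallier2023, §6.4.1] -/
theorem law_pos (A : Matrix Λ Λ ℝ) (h : Λ → ℝ) (β : ℝ) (σ : Λ → ℤˣ) : 0 < law A h β σ :=
  div_pos (weight_pos A h β σ) (Z_pos A h β)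

/-- The Ising law sums to one. [cite: BauerschmidtBodineauDagallier2023, §6.4.1] -/
theorem sum_law (A : Matrix Λ Λ ℝ) (h : Λ → ℝ) (β : ℝ) : ∑ σ, law A h β σ = 1 := by
  unfold law
  rw [← sum_div]
  change Z A h β / Z A h β = 1
  exact div_self (Z_pos A h β).ne'

/-! ## Entropy and the theorem -/

/-- `Ent_π(F) = E_π[F log F] − E_π[F] log E_π[F]` ([BBD] §2.1, `Φ(x) = x log x`, with `Φ(0) = 0`).
[cite: BauerschmidtBodineauDagallier2023, §2.1] -/
noncomputable def ent (π : (Λ → ℤˣ) → ℝ) (F : (Λ → ℤˣ) → ℝ) : ℝ :=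
  (∑ σ, π σ * (F σ * Real.log (F σ))) - (∑ σ, π σ * F σ) * Real.log (∑ σ, π σ * F σ)

/-- **[BBD] Theorem 10 — the spectral high-temperature log-Sobolev inequality (Bauerschmidt–Bodineau 2019).**
For every finite set `Λ`, every real symmetric coupling matrix `A` with spectrum in `[0,1]`, every field
`h : Λ → ℝ` and every `0 < β < 1`, the Ising model `μ(σ) ∝ exp(−½ β (σ, Aσ) + (h, σ))` satisfies, for each
`F : {−1,1}^Λ → ℝ₊`, `Ent_μ(F) ≤ (1 + 2β/(1−β)) D_μ(√F)` with the standard single-flip Dirichlet form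
`D_μ(G) = ½ Σ_x E_μ[(G(σ) − G(σ^x))²]` — a log-Sobolev inequality UNIFORM in `Λ`, `A` and `h`.  Named `Prop` fact
(D-0014); printed proof: Hubbard–Stratonovich decomposition + Bakry–Émery for the (convex, `β < 1`) renormalised
measure + the two-point inequality ([BBD] §6.4.3). [cite: BauerschmidtBodineauDagallier2023, Theorem 10] -/
def BauerschmidtBodineau2019_logSobolev : Prop :=
  ∀ (Λ : Type) [Fintype Λ] [DecidableEq Λ] (A : Matrix Λ Λ ℝ) (h : Λ → ℝ) (β : ℝ),
    A.PosSemidef → (1 - A).PosSemidef → 0 < β → β < 1 →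
      ∀ F : (Λ → ℤˣ) → ℝ, (∀ σ, 0 ≤ F σ) →
        ent (law A h β) F ≤ (1 + 2 * β / (1 - β)) * dirichletForm (law A h β) flipKernel (fun σ => Real.sqrt (F σ))

end Flip

end SpectralIsing

end Literature.Probability.MarkovChains
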